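import Mathlib
import HarnessLib
import Literature.MathematicalPhysics.StatisticalMechanics.RenormalisationMapSmallnessDegree

/-!
# The kernel-difference slot of the two-kernel reblocked sum is MAJORISED by the one-kernel Lipschitz slot in letters
# ([ABKM19] Lemma 9.6 at first order ⊗ Lemma 8.4; bookkeeping for hypothesis (12.53) of Lemma 12.6)

The two-kernel four-summand bound of the reblocked double sum (`RenormalisationMapKernelSubFamilies.
tayNormLE_subsum_reblockTerm_kernel_sub_abkm`) differs from the one-kernel Lipschitz bound
(`RenormalisationMapLipschitzABKMQ.tayNormLE_subsum_reblockTerm_sub_abkm_of_stepKernelBounds`) only in the fourth (slot-difference)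
summand: `[X₂ ≠ ∅]·(Σ_{Y ⊆ X₂} b^{|X₂∖Y|_k} Π_{Z ∈ 𝓒(Y)} C a_Z)·ℓ·κ^{|X₂|_k}` (pair property of the two fluctuation operators,
`X₂ = X∖X₁`) instead of `Σ_Y [((b'+Δ_H)^{…} − b'^{…}) Π_Z C a_Z + b'^{…}(Π_Z (C + C_Δ) a_Z − Π_Z C a_Z)]·A_𝒫^{|X₂|_k}`
(variation of `(H, K)`).  Since the counting lemmas downstream (`reblockTerm_lipschitzConsts_le[_top]`,
RenormalisationMapSmallnessTerms[Top]) are ABSTRACT IN THE LETTERS, the two-kernel remainder bounds follow from the one-kernel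
proofs verbatim once the kernel slot is majorised by the letter slot with `b' := b`, `Δ_H := b`, `C_Δ := C`, `A_𝒫 ≥ κ`, up to
the overall factor `ℓ`: for `X₂ ≠ ∅` and `Y ⊆ X₂` either `X₂∖Y` has a block (`(2b)^n − b^n ≥ b^n`) or `Y` has a component
(`Π(2Ca) − Π(Ca) ≥ Π(Ca)`).

* **`kernelSlot_le_letterSlot`** — the displayed inequality (all letters `≥ 0`).

Everything is proved; no named fact.  Use (honest scope): tool for stub 1 of the line `banach_two_kernel` of the child
`TwoKernelSkBound` of the rung route `Summits/HubbardSuperconductivity/…/Theses/ComplexGFFStiffness`; nothing about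
superconductivity in the Hubbard model.

## References
* S. Adams, S. Buchholz, R. Kotecký, S. Müller, arXiv:1910.13564, Lemma 9.6 (proof, first order), Lemma 12.6 (12.53)
  [AdamsBuchholzKoteckyMuller2019].
-/

noncomputable section

namespace Literature.MathematicalPhysics.StatisticalMechanics.GradientRG

open scoped BigOperators Classical
open Finset
open Literature.MathematicalPhysics.StatisticalMechanics.TorusPolymer
  (IsPolymer blocks polys numBlocks mem_polys one_le_card_blocks_of_nonempty one_le_card_components)
open Literature.Barriers.CriticalPhenomena.LongRangePhi4.Polymer (components)

variable {d M : ℕ} [NeZero M]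

/-- **The kernel-difference slot is majorised by the letter slot** (module docstring):
`[X₂ ≠ ∅]·(Σ_Y b^{|X₂∖Y|} Π_Z C a_Z)·ℓ·κ^{|X₂|} ≤ ℓ·(Σ_Y [((b+b)^{|X₂∖Y|} − b^{|X₂∖Y|}) Π_Z C a_Z + b^{|X₂∖Y|}(Π_Z (C a_Z + C a_Z) − Π_Z C a_Z)])·A_𝒫^{|X₂|}`
for `b, C, ℓ, κ ≥ 0`, `κ ≤ A_𝒫`, `a ≥ 0`. [cite: AdamsBuchholzKoteckyMuller2019, Lemma 9.6 (proof, first order) / Lemma 12.6 (12.53)] -/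
theorem kernelSlot_le_letterSlot (s : ℕ) {b C ℓ κ A𝒫 : ℝ} (hb : 0 ≤ b) (hC : 0 ≤ C) (hℓ : 0 ≤ ℓ) (hκ : 0 ≤ κ)
    (hκA : κ ≤ A𝒫) {aF : Finset (Fin d → ZMod M) → ℝ} (haF : ∀ Z, 0 ≤ aF Z) (X₂ : Finset (Fin d → ZMod M)) :
    (if X₂ = ∅ then 0 else
      (∑ Y ∈ polys s X₂, (∏ _B ∈ blocks s (X₂ \ Y), b) * ∏ Z ∈ components Y, C * aF Z) * ℓ * κ ^ numBlocks s X₂) ≤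
    ℓ * ((∑ Y ∈ polys s X₂,
        (((∏ _B ∈ blocks s (X₂ \ Y), (b + b)) - ∏ _B ∈ blocks s (X₂ \ Y), b) * ∏ Z ∈ components Y, C * aF Z +
          (∏ _B ∈ blocks s (X₂ \ Y), b) * ((∏ Z ∈ components Y, (C * aF Z + C * aF Z)) - ∏ Z ∈ components Y, C * aF Z))) *
      A𝒫 ^ numBlocks s X₂) := by
  -- the two slot summands, per `Y`
  set f : Finset (Fin d → ZMod M) → ℝ := fun Y => (∏ _B ∈ blocks s (X₂ \ Y), b) * ∏ Z ∈ components Y, C * aF Z with hf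
  set g : Finset (Fin d → ZMod M) → ℝ := fun Y =>
    ((∏ _B ∈ blocks s (X₂ \ Y), (b + b)) - ∏ _B ∈ blocks s (X₂ \ Y), b) * ∏ Z ∈ components Y, C * aF Z +
      (∏ _B ∈ blocks s (X₂ \ Y), b) * ((∏ Z ∈ components Y, (C * aF Z + C * aF Z)) - ∏ Z ∈ components Y, C * aF Z)
    with hg
  have hP0 : ∀ Y, 0 ≤ ∏ Z ∈ components Y, C * aF Z := fun Y => prod_nonneg fun Z _ => mul_nonneg hC (haF Z)
  have hbn : ∀ Y, (∏ _B ∈ blocks s (X₂ \ Y), b) = b ^ (blocks s (X₂ \ Y)).card := fun Y => prod_const b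
  have hb2n : ∀ Y, (∏ _B ∈ blocks s (X₂ \ Y), (b + b)) = (2 : ℝ) ^ (blocks s (X₂ \ Y)).card * b ^ (blocks s (X₂ \ Y)).card :=
    fun Y => by rw [prod_const, ← two_mul, mul_pow]
  have hP2 : ∀ Y, (∏ Z ∈ components Y, (C * aF Z + C * aF Z)) =
      (2 : ℝ) ^ (components Y).card * ∏ Z ∈ components Y, C * aF Z := fun Y => by
    rw [← prod_const (2 : ℝ), ← prod_mul_distrib]
    exact prod_congr rfl fun Z _ => by ring
  -- `g Y = (2^{n} + 2^{j} − 2) b^n P`, `f Y = b^n P`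
  have hfg : ∀ Y, g Y = ((2 : ℝ) ^ (blocks s (X₂ \ Y)).card + (2 : ℝ) ^ (components Y).card - 2) * f Y := by
    intro Y
    simp only [hf, hg, hbn, hb2n, hP2]
    ring
  have hf0 : ∀ Y, 0 ≤ f Y := fun Y => by
    simp only [hf]; exact mul_nonneg (prod_nonneg fun _ _ => hb) (hP0 Y)
  have hg0 : ∀ Y, 0 ≤ g Y := fun Y => by
    rw [hfg Y]
    have h1 : (1 : ℝ) ≤ (2 : ℝ) ^ (blocks s (X₂ \ Y)).card := one_le_pow₀ (by norm_num)
    have h2 : (1 : ℝ) ≤ (2 : ℝ) ^ (components Y).card := one_le_pow₀ (by norm_num)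
    exact mul_nonneg (by linarith) (hf0 Y)
  by_cases hX : X₂ = ∅
  · rw [if_pos hX]
    have hA0 : 0 ≤ A𝒫 := hκ.trans hκA
    exact mul_nonneg hℓ (mul_nonneg (sum_nonneg fun Y _ => hg0 Y) (pow_nonneg hA0 _))
  · rw [if_neg hX]
    have hXne : X₂.Nonempty := nonempty_iff_ne_empty.2 hX
    -- termwise `f Y ≤ g Y` for `Y ⊆ X₂`, `X₂ ≠ ∅`
    have hle : ∀ Y ∈ polys s X₂, f Y ≤ g Y := by
      intro Y hY
      rw [hfg Y]
      obtain ⟨hYX, -⟩ := mem_polys.1 hY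
      have h1 : (1 : ℝ) ≤ (2 : ℝ) ^ (blocks s (X₂ \ Y)).card := one_le_pow₀ (by norm_num)
      have h2 : (1 : ℝ) ≤ (2 : ℝ) ^ (components Y).card := one_le_pow₀ (by norm_num)
      have hsum : (2 : ℝ) ≤ (2 : ℝ) ^ (blocks s (X₂ \ Y)).card + (2 : ℝ) ^ (components Y).card - 1 := by
        rcases Y.eq_empty_or_nonempty with rfl | hYne
        · have hn : 1 ≤ (blocks s (X₂ \ ∅)).card := by
            rw [sdiff_empty]; exact one_le_card_blocks_of_nonempty s hXne
          have : (2 : ℝ) ^ 1 ≤ (2 : ℝ) ^ (blocks s (X₂ \ ∅)).card := pow_le_pow_right₀ (by norm_num) hn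
          linarith
        · have hj : 1 ≤ (components Y).card := one_le_card_components hYne
          have : (2 : ℝ) ^ 1 ≤ (2 : ℝ) ^ (components Y).card := pow_le_pow_right₀ (by norm_num) hj
          linarith
      have hf0Y := hf0 Y
      nlinarith
    have hsumle : ∑ Y ∈ polys s X₂, f Y ≤ ∑ Y ∈ polys s X₂, g Y := sum_le_sum hle
    have hS0 : 0 ≤ ∑ Y ∈ polys s X₂, f Y := sum_nonneg fun Y _ => hf0 Y
    have hSg0 : 0 ≤ ∑ Y ∈ polys s X₂, g Y := sum_nonneg fun Y _ => hg0 Y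
    have hpow : κ ^ numBlocks s X₂ ≤ A𝒫 ^ numBlocks s X₂ := pow_le_pow_left₀ hκ hκA _
    have hκn : 0 ≤ κ ^ numBlocks s X₂ := pow_nonneg hκ _
    calc (∑ Y ∈ polys s X₂, f Y) * ℓ * κ ^ numBlocks s X₂
        = ℓ * ((∑ Y ∈ polys s X₂, f Y) * κ ^ numBlocks s X₂) := by ring
      _ ≤ ℓ * ((∑ Y ∈ polys s X₂, g Y) * A𝒫 ^ numBlocks s X₂) :=
          mul_le_mul_of_nonneg_left (mul_le_mul hsumle hpow hκn hSg0) hℓ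

end Literature.MathematicalPhysics.StatisticalMechanics.GradientRG

end
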